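import Summits.QuantumFields.YangMills.Theorems.BalabanUVNodesN11CondExpOfFibrewiseIdentity

/-!
# DAG node N11 — THE FROZEN-`y` FIBREWISE IDENTITY NEEDS ONLY NONNEGATIVE BOUNDED CONTINUOUS TESTS OF THE NEW VARIABLES: the transported old density and the candidate define two
# finite Borel measures on the compact metrizable space `sV'ᶜ → SU(N)`; bounded continuous functions separate them (Mathlib's `HasOuterApproxClosed`), and the candidate's integrability follows

HEADER — WORK-UNIT METADATA.  Cell `pub-ymgap`, YM-PLAN Track A (D-0062), seat `pub-ymgap-dag-n11-d` (g17; N11 [B14], s2), route `BalabanUVNodes`, item K1⁹ = stmt-QuantumFields-27364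
(helper lane, `--kind proof --supports 27364 --as helper`, count-neutral).  [I] = [Balaban1987RG1], [III] = [Balaban1988Convergent].  Sequel of this seat's g17
`…N11CondExpOfFibrewiseIdentity` (the Fubini reduction: (hweak) ∕ (hce₀) from the frozen-`y` fibrewise identity (hfib) with ALL bounded measurable tests `h`).  Mathlib:
`ext_of_forall_lintegral_eq_of_IsFiniteMeasure` (finite Borel measures on a space with `HasOuterApproxClosed` are determined by the integrals of `X →ᵇ ℝ≥0`),
`isFiniteMeasure_withDensity_ofReal`, `lintegral_map`, `lintegral_withDensity_eq_lintegral_mul₀`, `integral_withDensity_eq_integral_toReal_smul₀`.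

WHY THIS FILE.  An analyst proving (hfib) — print's (3.10)–(3.25) at frozen retained variables — computes `∫ piece(e⁻¹(y,u))·h(Ū(e⁻¹(y,u))|_{new}) du` by a change of variables and
dominated ∕ monotone convergence arguments that are natural for CONTINUOUS test functions `h` of the new coarse variables, not for arbitrary bounded Borel ones.  Nothing is
lost: for `ρ ≥ 0` integrable and a candidate `R ≥ 0` measurable, the two sides of (hfib) are the integrals of `h` against two Borel measures on `V₂ = (sV'ᶜ → SU(N))` — the
push-forward `(ρ_y·du).map φ_y` (finite) and `R(y,·)·dv` — and `V₂` is compact metrizable, so agreement on nonnegative bounded continuous tests (in the `∫⁻` form, which needs no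
integrability of `R`) gives equality of the measures, whence FINITENESS of `R(y,·)·dv` (= integrability of the candidate on the fibre) and (hfib) for every bounded measurable `h`.

WHAT THIS FILE PROVES (0 `def`, 0 `sorry`, standard axioms).  §1 (generic; `V` a topological Borel space with `HasOuterApproxClosed`): ★ `map_withDensity_eq_of_bcf` · ★★
`fibre_identity_of_bcf` (integrability of the candidate ∧ the identity for all bounded measurable tests).  §2 (record letters): ★★ `fibrewise_at_record_of_bcfTests` ((hfib) of
`…N11CondExpOfFibrewiseIdentity` from `∫⁻`-tests against `V₂ →ᵇ ℝ≥0`, per frozen `y`) · ★★★ `condExp_identity_of_bcfTests_of_nonneg` ((hce₀) at 11a's letters from the same).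

HONEST FRAMING.  Helper lane of K1⁹; count-neutral; [folklore] measure theory over def-T's definitions; the continuous-test identity is DISPLAYED ([I] §2 + [15] Sect. C + ζ + [III]
Thm 2), not proved; nothing of Bałaban asserted; N11 NOT discharged; K1⁹ NOT closed, no registered stub touched; counts unmoved (typed 28∕28 · discharged 5∕27 · A 5∕28).  One finite
`𝕋⁴_{L^K}` programme at fixed `ε = L^{−K}` — NOT ℝ⁴, NOT OS, NOT a mass gap, NOT Clay.  No `sorry`, `axiom`, `def`, `instance`, `notation`.  Sources (SHAPE only): [III] (2.21)
p.258, (3.1) p.264, (3.10)–(3.11) p.266, (3.12)–(3.14) p.267, (3.23)–(3.25) p.270; [I] (0.4) p.253, §2 p.267.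
-/

noncomputable section

open MeasureTheory ProbabilityTheory BoundedContinuousFunction
open scoped ENNReal NNReal BigOperators

namespace Summit.QuantumFields.YangMills.Theorems.BalabanUVNodesN11FibrewiseIdentityOfContinuousTests

open Literature.MathematicalPhysics.QuantumFieldTheory.Balaban1983to89
open Literature.MathematicalPhysics.QuantumFieldTheory.Balaban1983to89.T4AveragingDisintegration
open BalabanUVNodesN11CondExpOfFibrewiseIdentity (condExp_identity_of_fibrewise_of_nonneg)
open Node00 hiding SU
open Node00.Tk T4Continuum
open B10Eq42TorusConstraint (bondsIn)

/-! ## §1  Generic: two finite Borel measures, nonnegative bounded continuous tests -/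

section Generic

variable {U V : Type*} [MeasurableSpace U] [TopologicalSpace V] [MeasurableSpace V] [BorelSpace V] [HasOuterApproxClosed V]

/-- ★ **THE TRANSPORTED DENSITY MEASURE IS DETERMINED BY NONNEGATIVE BOUNDED CONTINUOUS TESTS**: if `∫⁻ ofReal(ρ)·f∘φ dν = ∫⁻ ofReal(R)·f dμ₂` for every `f : V →ᵇ ℝ≥0`, then
`(ρ·ν).map φ = R·μ₂` as measures (`ν` finite, `ρ` integrable ⇒ the left side is a finite measure; Mathlib's `ext_of_forall_lintegral_eq_of_IsFiniteMeasure` on a space with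
`HasOuterApproxClosed`, e.g. any pseudo-metrizable space). [folklore] -/
theorem map_withDensity_eq_of_bcf (ν : Measure U) [IsFiniteMeasure ν] (μ₂ : Measure V)
    {φ : U → V} (hφ : Measurable φ) {ρ : U → ℝ} (hρ : Integrable ρ ν) {R : V → ℝ} (hRm : Measurable R)
    (htest : ∀ f : V →ᵇ ℝ≥0, ∫⁻ u, ENNReal.ofReal (ρ u) * f (φ u) ∂ν = ∫⁻ v, ENNReal.ofReal (R v) * f v ∂μ₂) :
    (ν.withDensity fun u => ENNReal.ofReal (ρ u)).map φ = μ₂.withDensity fun v => ENNReal.ofReal (R v) := by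
  haveI : IsFiniteMeasure (ν.withDensity fun u => ENNReal.ofReal (ρ u)) := isFiniteMeasure_withDensity_ofReal hρ.2
  haveI : IsFiniteMeasure ((ν.withDensity fun u => ENNReal.ofReal (ρ u)).map φ) := Measure.isFiniteMeasure_map _ _
  refine ext_of_forall_lintegral_eq_of_IsFiniteMeasure fun f => ?_
  have hfm : Measurable fun v => (f v : ℝ≥0∞) := measurable_coe_nnreal_ennreal.comp f.continuous.measurable
  rw [lintegral_map hfm hφ,
    lintegral_withDensity_eq_lintegral_mul₀ hρ.1.aemeasurable.ennreal_ofReal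
      (show AEMeasurable (fun a => (f (φ a) : ℝ≥0∞)) ν from (hfm.comp hφ).aemeasurable),
    lintegral_withDensity_eq_lintegral_mul₀ hRm.ennreal_ofReal.aemeasurable hfm.aemeasurable]
  simpa only [Pi.mul_apply] using htest f

/-- ★★ **THE FIBREWISE IDENTITY FOR ALL BOUNDED MEASURABLE TESTS FROM NONNEGATIVE BOUNDED CONTINUOUS TESTS**, candidate nonnegative and measurable — AND the candidate's
integrability DERIVED (its `withDensity` measure is the finite push-forward): the measure identity of `map_withDensity_eq_of_bcf` integrated against `h`. [folklore] -/
theorem fibre_identity_of_bcf (ν : Measure U) [IsFiniteMeasure ν] (μ₂ : Measure V)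
    {φ : U → V} (hφ : Measurable φ) {ρ : U → ℝ} (hρ : Integrable ρ ν) (hρ0 : 0 ≤ᵐ[ν] ρ)
    {R : V → ℝ} (hR0 : ∀ v, 0 ≤ R v) (hRm : Measurable R)
    (htest : ∀ f : V →ᵇ ℝ≥0, ∫⁻ u, ENNReal.ofReal (ρ u) * f (φ u) ∂ν = ∫⁻ v, ENNReal.ofReal (R v) * f v ∂μ₂) :
    Integrable R μ₂ ∧ ∀ h : V → ℝ, Measurable h → (∃ C : ℝ, ∀ v, |h v| ≤ C) →
      ∫ u, ρ u * h (φ u) ∂ν = ∫ v, R v * h v ∂μ₂ := by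
  have hmeas := map_withDensity_eq_of_bcf ν μ₂ hφ hρ hRm htest
  haveI : IsFiniteMeasure (ν.withDensity fun u => ENNReal.ofReal (ρ u)) := isFiniteMeasure_withDensity_ofReal hρ.2
  -- integrability of `R`: its `withDensity` measure is the (finite) push-forward
  have hRint : Integrable R μ₂ := by
    refine ⟨hRm.aestronglyMeasurable, ?_⟩
    have h1 : ∫⁻ v, ENNReal.ofReal (R v) ∂μ₂ = (μ₂.withDensity fun v => ENNReal.ofReal (R v)) Set.univ := by
      rw [withDensity_apply _ MeasurableSet.univ, Measure.restrict_univ]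
    have h2 : ∫⁻ v, ‖R v‖ₑ ∂μ₂ = ∫⁻ v, ENNReal.ofReal (R v) ∂μ₂ := lintegral_congr fun v => Real.enorm_eq_ofReal (hR0 v)
    show ∫⁻ v, ‖R v‖ₑ ∂μ₂ < ∞
    rw [h2, h1, ← hmeas]
    exact measure_lt_top _ _
  refine ⟨hRint, fun h hh hC => ?_⟩
  obtain ⟨C, hC⟩ := hC
  -- both sides are the integral of `h` against the two equal measures
  have hL : ∫ u, ρ u * h (φ u) ∂ν = ∫ x, h x ∂((ν.withDensity fun u => ENNReal.ofReal (ρ u)).map φ) := by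
    rw [integral_map hφ.aemeasurable hh.aestronglyMeasurable,
      integral_withDensity_eq_integral_toReal_smul₀ hρ.1.aemeasurable.ennreal_ofReal (Filter.Eventually.of_forall fun _ => ENNReal.ofReal_lt_top)]
    refine integral_congr_ae ?_
    filter_upwards [hρ0] with u hu
    rw [ENNReal.toReal_ofReal hu, smul_eq_mul]
  have hR' : ∫ v, R v * h v ∂μ₂ = ∫ x, h x ∂(μ₂.withDensity fun v => ENNReal.ofReal (R v)) := by
    rw [integral_withDensity_eq_integral_toReal_smul₀ hRm.ennreal_ofReal.aemeasurable (Filter.Eventually.of_forall fun _ => ENNReal.ofReal_lt_top)]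
    exact integral_congr_ae (ae_of_all _ fun v =>
      (by rw [ENNReal.toReal_ofReal (hR0 v), smul_eq_mul] : R v * h v = (ENNReal.ofReal (R v)).toReal • h v))
  rw [hL, hR', hmeas]

end Generic

/-! ## §2  Record letters: the frozen-`y` fibrewise identity, (hweak) and (hce₀) from nonnegative bounded CONTINUOUS tests of the new variables -/

section Record

variable {F : T4Family} {N : ℕ} [NeZero N]

/-- ★★ **THE FROZEN-`y` FIBREWISE IDENTITY AT THE RECORD LETTERS FROM CONTINUOUS TESTS** (ANY `dU`-integrable `ρ ≥ 0`, any finite bond sets `sV`, `sV'`; candidate `R ≥ 0`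
measurable): if for `(⊗_{sV} dU)`-a.e. `y` and every NONNEGATIVE BOUNDED CONTINUOUS `f` of the new variables `v : sV'ᶜ → SU(N)` (a compact metrizable group),
`∫⁻ ofReal(ρ(e⁻¹(y,u)))·f(Ū(e⁻¹(y,u))|_{new}) du = ∫⁻ ofReal(R(y,v))·f(v) dv`, then (hfib) of `…N11CondExpOfFibrewiseIdentity` holds (all bounded measurable tests). [cite: Balaban1988Convergent, (3.1) p.264, (3.23)–(3.25) p.270; Balaban1987RG1, (0.4) p.253, §2 p.267] -/
theorem fibrewise_at_record_of_bcfTests (K k : ℕ) {hdec : DecidableEq (PBond (F.P K) k)} {hdec' : DecidableEq (PBond (F.P K) (k + 1))}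
    (sV : Finset (PBond (F.P K) k)) (sV' : Finset (PBond (F.P K) (k + 1)))
    {ρ : GaugeField (F.P K) k (SU N) → ℝ} (hρ : Integrable ρ (fieldMeasure (F.P K) k (SU N))) (hρ0 : ∀ U, 0 ≤ ρ U)
    {R : (↥sV → SU N) × ({c : PBond (F.P K) (k + 1) // c ∉ sV'} → SU N) → ℝ} (hR0 : ∀ z, 0 ≤ R z) (hRm : Measurable R)
    (htest : ∀ᵐ y ∂(Measure.pi fun _ : ↥sV => (HaarData.haar : Measure (SU N))),
      ∀ f : ({c : PBond (F.P K) (k + 1) // c ∉ sV'} → SU N) →ᵇ ℝ≥0,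
        ∫⁻ u, ENNReal.ofReal (ρ ((MeasurableEquiv.piEquivPiSubtypeProd (fun _ : PBond (F.P K) k => SU N) (· ∈ sV)).symm (y, u))) *
            f (fun c : {c : PBond (F.P K) (k + 1) // c ∉ sV'} =>
              (avOfRecord F N K k).avg ((MeasurableEquiv.piEquivPiSubtypeProd (fun _ : PBond (F.P K) k => SU N) (· ∈ sV)).symm (y, u)) c)
          ∂(Measure.pi fun _ : {b : PBond (F.P K) k // b ∉ sV} => (HaarData.haar : Measure (SU N))) =
        ∫⁻ v, ENNReal.ofReal (R (y, v)) * f v ∂(Measure.pi fun _ : {c : PBond (F.P K) (k + 1) // c ∉ sV'} => (HaarData.haar : Measure (SU N)))) :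
    ∀ᵐ y ∂(Measure.pi fun _ : ↥sV => (HaarData.haar : Measure (SU N))),
      ∀ h : ({c : PBond (F.P K) (k + 1) // c ∉ sV'} → SU N) → ℝ, Measurable h → (∃ C : ℝ, ∀ v, |h v| ≤ C) →
        ∫ u, ρ ((MeasurableEquiv.piEquivPiSubtypeProd (fun _ : PBond (F.P K) k => SU N) (· ∈ sV)).symm (y, u)) *
            h (fun c : {c : PBond (F.P K) (k + 1) // c ∉ sV'} =>
              (avOfRecord F N K k).avg ((MeasurableEquiv.piEquivPiSubtypeProd (fun _ : PBond (F.P K) k => SU N) (· ∈ sV)).symm (y, u)) c)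
          ∂(Measure.pi fun _ : {b : PBond (F.P K) k // b ∉ sV} => (HaarData.haar : Measure (SU N))) =
        ∫ v, R (y, v) * h v ∂(Measure.pi fun _ : {c : PBond (F.P K) (k + 1) // c ∉ sV'} => (HaarData.haar : Measure (SU N))) := by
  have hpres := measurePreserving_piEquivPiSubtypeProd_symm_fieldMeasure (G := SU N) (P := F.P K) (j := k) sV
  have hρ' := (hpres.integrable_comp hρ.aestronglyMeasurable).mpr hρ
  have hφ := measurable_avOfRecord_glue_rest F N K k sV sV'
  filter_upwards [htest, hρ'.prod_right_ae] with y hy hρy h hh hC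
  exact (fibre_identity_of_bcf (Measure.pi fun _ : {b : PBond (F.P K) k // b ∉ sV} => (HaarData.haar : Measure (SU N)))
    (Measure.pi fun _ : {c : PBond (F.P K) (k + 1) // c ∉ sV'} => (HaarData.haar : Measure (SU N)))
    (hφ.comp measurable_prodMk_left) hρy (ae_of_all _ fun u => hρ0 _) (fun v => hR0 (y, v)) (hRm.comp measurable_prodMk_left) hy).2 h hh hC

/-- ★★★ **(hce₀) AT 11a's GENERATION LETTERS FROM NONNEGATIVE BOUNDED CONTINUOUS TESTS PER FROZEN `y`** (candidate nonnegative and measurable, `ρ ≥ 0` integrable):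
§2 ∘ `…N11CondExpOfFibrewiseIdentity.condExp_identity_of_fibrewise_of_nonneg`. [cite: Balaban1988Convergent, (2.21) p.258, (3.1) p.264, (3.23)–(3.25) p.270; Balaban1987RG1, (0.4) p.253, §2 p.267] -/
theorem condExp_identity_of_bcfTests_of_nonneg (ν : Stage7Numerics) (M : ℕ) (g : ℕ → ℝ) (p : B12.RunParams)
    {k : ℕ} {hdec : DecidableEq (PBond (F.P p.K) k)} {hdec' : DecidableEq (PBond (F.P p.K) (k + 1))} (hk : k + 1 ≤ (F.P p.K).m + (F.P p.K).K)
    (s' : SeqOfRecord F ν M g p.K (k + 1)) {ρ : GaugeField (F.P p.K) k (SU N) → ℝ} (hρ : Integrable ρ (fieldMeasure (F.P p.K) k (SU N))) (hρ0 : ∀ U, 0 ≤ ρ U)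
    {R : ((↥(Set.toFinite (bondsIn k (s'.Ω (k + 1))ᶜ)).toFinset → SU N) × ({c : PBond (F.P p.K) (k + 1) // c ∉ (Set.toFinite (bondsIn (k + 1) (s'.Ω (k + 1))ᶜ)).toFinset} → SU N)) → ℝ}
    (hR0 : ∀ z, 0 ≤ R z) (hRm : Measurable R)
    (htest : ∀ᵐ y ∂(Measure.pi fun _ : ↥(Set.toFinite (bondsIn k (s'.Ω (k + 1))ᶜ)).toFinset => (HaarData.haar : Measure (SU N))),
      ∀ f : ({c : PBond (F.P p.K) (k + 1) // c ∉ (Set.toFinite (bondsIn (k + 1) (s'.Ω (k + 1))ᶜ)).toFinset} → SU N) →ᵇ ℝ≥0,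
        ∫⁻ u, ENNReal.ofReal (ρ ((MeasurableEquiv.piEquivPiSubtypeProd (fun _ : PBond (F.P p.K) k => SU N)
              (· ∈ (Set.toFinite (bondsIn k (s'.Ω (k + 1))ᶜ)).toFinset)).symm (y, u))) *
            f (fun c : {c : PBond (F.P p.K) (k + 1) // c ∉ (Set.toFinite (bondsIn (k + 1) (s'.Ω (k + 1))ᶜ)).toFinset} =>
              (avOfRecord F N p.K k).avg ((MeasurableEquiv.piEquivPiSubtypeProd (fun _ : PBond (F.P p.K) k => SU N)
                (· ∈ (Set.toFinite (bondsIn k (s'.Ω (k + 1))ᶜ)).toFinset)).symm (y, u)) c)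
          ∂(Measure.pi fun _ : {b : PBond (F.P p.K) k // b ∉ (Set.toFinite (bondsIn k (s'.Ω (k + 1))ᶜ)).toFinset} => (HaarData.haar : Measure (SU N))) =
        ∫⁻ v, ENNReal.ofReal (R (y, v)) * f v ∂(Measure.pi fun _ : {c : PBond (F.P p.K) (k + 1) // c ∉ (Set.toFinite (bondsIn (k + 1) (s'.Ω (k + 1))ᶜ)).toFinset} =>
          (HaarData.haar : Measure (SU N)))) :
    kernelTransport
        ((Measure.pi fun _ : ↥(Set.toFinite (bondsIn k (s'.Ω (k + 1))ᶜ)).toFinset => (HaarData.haar : Measure (SU N))).prod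
          (Measure.pi fun _ : {b : PBond (F.P p.K) k // b ∉ (Set.toFinite (bondsIn k (s'.Ω (k + 1))ᶜ)).toFinset} => (HaarData.haar : Measure (SU N))))
        ((Measure.pi fun _ : ↥(Set.toFinite (bondsIn k (s'.Ω (k + 1))ᶜ)).toFinset => (HaarData.haar : Measure (SU N))).prod
          (Measure.pi fun _ : {c : PBond (F.P p.K) (k + 1) // c ∉ (Set.toFinite (bondsIn (k + 1) (s'.Ω (k + 1))ᶜ)).toFinset} =>
            (HaarData.haar : Measure (SU N))))
        (fun q => (q.1, fun c : {c : PBond (F.P p.K) (k + 1) // c ∉ (Set.toFinite (bondsIn (k + 1) (s'.Ω (k + 1))ᶜ)).toFinset} =>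
          (avOfRecord F N p.K k).avg
            ((MeasurableEquiv.piEquivPiSubtypeProd (fun _ : PBond (F.P p.K) k => SU N)
              (· ∈ (Set.toFinite (bondsIn k (s'.Ω (k + 1))ᶜ)).toFinset)).symm q) c))
        (ρ ∘ ⇑(MeasurableEquiv.piEquivPiSubtypeProd (fun _ : PBond (F.P p.K) k => SU N)
            (· ∈ (Set.toFinite (bondsIn k (s'.Ω (k + 1))ᶜ)).toFinset)).symm)
      =ᵐ[((Measure.pi fun _ : ↥(Set.toFinite (bondsIn k (s'.Ω (k + 1))ᶜ)).toFinset => (HaarData.haar : Measure (SU N))).prod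
          (Measure.pi fun _ : {c : PBond (F.P p.K) (k + 1) // c ∉ (Set.toFinite (bondsIn (k + 1) (s'.Ω (k + 1))ᶜ)).toFinset} =>
            (HaarData.haar : Measure (SU N))))] R :=
  condExp_identity_of_fibrewise_of_nonneg ν M g p (hdec := hdec) (hdec' := hdec') hk s' hρ hR0 hRm
    (fibrewise_at_record_of_bcfTests p.K k (hdec := hdec) (hdec' := hdec') _ _ hρ hρ0 hR0 hRm htest)

end Record

end Summit.QuantumFields.YangMills.Theorems.BalabanUVNodesN11FibrewiseIdentityOfContinuousTests

end
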